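import Summits.KontsevichZagierPeriods.KontsevichZagierPeriods.Theorems.KzOnePeriodsE1XiLog

/-!
# KontsevichZagierPeriods — kz1p third kind on the pole chart, part 4: the rule `IMG2` and a second arc

Cell pub-kz1p, seat b2b-kz1p-2, gen 22 (kz1p v2.6, shape (Ξ′); PROCEDURE.md §4j; LEAN-IN-TREE rule).  Pure
mathematics over the tree's formal period space `Literature.NumberTheory.Transcendental.CurvePeriods`
([cite: HuberWustholz2022, §13.1 (p. 120), Thm 13.3 (2) (p. 121)]); no named facts, no `sorry`; notations local.

kz1p's third-kind symbol `ξ_P(g) = ∫_g (y + y_P)/(x − x_P) · dx/y` (class E1, `P = (x_P, y_P)` algebraic, `g` a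
path on `E(ℝ)` resp. its unit image) is the tree symbol `(E^w(x_P), ξ_P, g^w)` on the pole chart (parts 1–2).
kz1p's certificate rule **`IMG2`** (tests E1-21, E1-22, row `IMG2-A-g1-Ai-g2`): on `y² = x³ + ax` with the exact
unit `[i](x, y) = (−x, iy)`, for a pole `A = (x_A, y_A)`, its image `Ai = [i]A`, a path `g1` and `g2 = [i]g1`,
`ξ_{Ai}(g1) + ξ_A(g2) − 2·LOGX_A(g2) = 0`, `LOGX_A(g2) = [log(x − x_A)]_{g2} = log((x(g2(1)) − x_A)/(x(g2(0)) − x_A))`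
(a real logarithm of a positive rational).  Its derivation from (R1)–(R5), for EVERY such pair of paths:

* `xi_img2_derivation` — `(E^w(−x₀), ξ_{(−x₀,y₀)}, γ) + (E^w(x₀), ξ_{(x₀,y₁)}, β) − 2·ℓ(log w) ∈ ⟨(R1)–(R5)⟩_ℚ̄` and
  `∫_γ ξ_{(−x₀,y₀)} + ∫_β ξ_{(x₀,y₁)} = 2 log w`, whenever `γ = [d]^w β` on `[0,1]` (`d² = −1`, `y₀ = −d·y₁`… i.e.
  `y₀ + d y₁ = 0`), the `x`-coordinate of `γ` is real `> −x₀` on `[0, 1]`, from `r(0)` to `r(1)`, and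
  `w·(r(0) + x₀) = r(1) + x₀`: (R4)+(R1) along `[d]^w` (`(ξ_{(−x₀, d y₁)}, γ) ∼ (ξ_{(x₀,y₁)}, β)`, part 2), (R1)+(R2)
  `ξ_{(−x₀,y₀)} + ξ_{(−x₀,−y₀)} ∼ 2 w dx`, (R4) `w dx = ψ^*(v du)` and (R5)+(R4) `(𝔾ₘ, v du, ψ∘γ) ∼ ℓ(log w)`
  (part 3) [cite: HuberWustholz2022, §13.1 (A), (B) (p. 120), §3.3.1 (pp. 42–43)];
* `exists_liftPair` — the two chart lifts used by the case files: `γ = g^w` on `E^w(−x₀)` and `β = ([d]g)^w` on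
  `E^w(x₀)`, with `γ = [−d]^w β`;
* `corpus_xi_img2` — the corpus form (`a ∈ {−1, −25, −1156, −36}`, `d = −i`, i.e. `β = ([i]g)^w`);
* `exists_arcPath2` — a `C¹` arc of `E_{A,B}(ℝ)` between two algebraic points of one real component on the same
  side of the `x`-axis (`x` affine in `t`, `y = y_a √(f(x))/√(f(x_a))`), complementing part 2's `exists_arcPath`
  (arc from a 2-torsion point); test E1-22's path `g1 : C → X`.
-/

noncomputable section

open scoped BigOperators
open MvPolynomial Set Complex Filter Topology
open Literature.NumberTheory.Transcendental Literature.NumberTheory.Transcendental.CurvePeriods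
open Summit.KontsevichZagierPeriods.KzOnePeriods.E1Derivation
open Summit.KontsevichZagierPeriods.KzOnePeriods.G2SDerivation

namespace Summit.KontsevichZagierPeriods.KzOnePeriods.XiDerivation

local notation3 "InSpanRel " c:arg => ∃ (k : ℕ) (ρ : Fin k → (PeriodSymbol →₀ ℂ))
  (a : Fin k → ℂ), (∀ l, IsElementaryRelation (ρ l)) ∧ (∀ l, IsAlgebraic ℚ (a l)) ∧
    c = ∑ l, a l • ρ l

/-- The symbol `(Z, ω, γ)` as an element of the formal period space. -/
local notation3 (prettyPrint := false) "Sy[" Z ", " hZ ", " ω ", " h ", " γ "]" =>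
  (Finsupp.single (⟨Z, hZ, ω, h, γ⟩ : PeriodSymbol) (1 : ℂ) : PeriodSymbol →₀ ℂ)

/-- The period `∫_γ ω` of the symbol `(Z, ω, γ)`. -/
local notation3 (prettyPrint := false) "Pe[" Z ", " hZ ", " ω ", " h ", " γ "]" =>
  PeriodSymbol.period (⟨Z, hZ, ω, h, γ⟩ : PeriodSymbol)

/-- The cubic `x³ + Ax + B ∈ ℂ[x, y, w]`. -/
local notation3 (prettyPrint := false) "fW[" A ", " B "]" =>
  ((X 0 : MvPolynomial (Fin 3) ℂ) ^ 3 + C A * X 0 + C B)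

/-- The pole chart `E^w_{A,B}(x₀) = {y² = x³ + Ax + B, (x − x₀)·w = 1} ⊂ 𝔸³`. -/
local notation3 (prettyPrint := false) "EW[" A ", " B ", " x₀ "]" =>
  (⟨3, 2, ![(X 1 : MvPolynomial (Fin 3) ℂ) ^ 2 - fW[A, B], (X 0 - C x₀) * X 2 - 1]⟩ : CurveData)

/-- The projection `pr = (x, y) : E^w → E`. -/
local notation3 (prettyPrint := false) "proj" => (![X 0, X 1] : Fin 2 → MvPolynomial (Fin 3) ℂ)

/-- **The third-kind form** `ξ_P = (y + y₀)·w · pr^*θ₀` on `E^w_{A,B}(x₀)`, `P = (x₀, y₀)`. -/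
local notation3 (prettyPrint := false) "ξ[" A ", " B ", " y₀ "]" =>
  ((((X 1 : MvPolynomial (Fin 3) ℂ) + C y₀) * X 2) • formPullback proj (Weier.theta0 A B))

/-- The multiplicative group `𝔾ₘ = {uv = 1} ⊂ 𝔸²`. -/
local notation3 (prettyPrint := false) "𝔾m" => (⟨2, 1, ![X 0 * X 1 - 1]⟩ : CurveData)

/-- The logarithm symbol `(𝔾ₘ, v du, E)` over a path `E` on `𝔾ₘ`. -/
local notation3 "logSym " E:arg => (⟨⟨2, 1, ![X 0 * X 1 - 1]⟩, isSmoothAffineCurve_mulGroup,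
  ![X 1, 0], hasAlgCoeffs_ydx, E⟩ : PeriodSymbol)

variable {A B x₀ : ℂ}

/-! ### The rule `IMG2` -/

/-- **kz1p's rule `IMG2`, for every pair of paths.**  On `y² = x³ + Ax` (`A ≠ 0`, `x₀ ∈ ℚ̄`, `d² = −1`,
`y₀ + d·y₁ = 0`), let `β` be a path on `E^w(x₀)` and `γ = [−d]^w β = (−x∘β, −d·y∘β, −w∘β)` on `[0, 1]` (a path on
`E^w(−x₀)`) whose `x`-coordinate is real, `x(γ(t)) = r(t) > −x₀`, and let `w·(r(0) + x₀) = r(1) + x₀`.  Then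
`(E^w(−x₀), ξ_{(−x₀,y₀)}, γ) + (E^w(x₀), ξ_{(x₀,y₁)}, β) − 2·ℓ(log w) ∈ ⟨(R1)–(R5)⟩_ℚ̄` and
`∫_γ ξ_{(−x₀,y₀)} + ∫_β ξ_{(x₀,y₁)} − 2 log w = 0` (`log w ∈ ℝ`; `ℓ(log w) = (𝔾ₘ, v du, (e^{t log w}, e^{−t log w}))`).
Moves: (R4)+(R1) along `[−d]^w`; (R1)+(R2) `ξ_Q + ξ_{−Q} ∼ 2 w dx`; (R4) along `ψ = (x + x₀, w)`; (R5)+(R4) to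
`ℓ(log w)` [cite: HuberWustholz2022, §13.1 (A), (B) (p. 120), §3.3.1 (pp. 42–43)]. -/
theorem xi_img2_derivation {d : ℂ} (hd : d ^ 2 = -1) (hE : EW[A, 0, x₀].IsSmoothAffineCurve)
    (hE' : EW[A, 0, -x₀].IsSmoothAffineCurve) (hD : Weier.disc A 0 ≠ 0) (hx₀ : IsAlgebraic ℚ x₀)
    {y₀ y₁ : ℂ} (hy : y₀ + d * y₁ = 0) (hξ₀ : ∀ i, HasAlgCoeffs (ξ[A, 0, y₀] i))
    (hξ₁ : ∀ i, HasAlgCoeffs (ξ[A, 0, y₁] i)) (hξd : ∀ i, HasAlgCoeffs (ξ[A, 0, d * y₁] i))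
    {β : CurvePath EW[A, 0, x₀]} {γ : CurvePath EW[A, 0, -x₀]}
    (hγ : ∀ t ∈ Icc (0 : ℝ) 1, γ.toFun t = ![-β.toFun t 0, d * β.toFun t 1, -β.toFun t 2])
    {xr : ℝ} (hxr : x₀ = xr) {r : ℝ → ℝ} (hr : ∀ t ∈ Icc (0 : ℝ) 1, γ.toFun t 0 = (r t : ℂ))
    (hpos : ∀ t ∈ Icc (0 : ℝ) 1, -xr < r t) {w : ℝ} (hw : w * (r 0 + xr) = r 1 + xr)
    (E : CurvePath 𝔾m)
    (hEd : ∀ t, E.toFun t = ![exp ((1 - t) * 0 + t * ((Real.log w : ℝ) : ℂ)),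
      exp (-((1 - t) * 0 + t * ((Real.log w : ℝ) : ℂ)))]) :
    InSpanRel (Sy[EW[A, 0, -x₀], hE', ξ[A, 0, y₀], hξ₀, γ] + Sy[EW[A, 0, x₀], hE, ξ[A, 0, y₁], hξ₁, β] -
        (2 : ℂ) • Finsupp.single (logSym E) 1) ∧
      Pe[EW[A, 0, -x₀], hE', ξ[A, 0, y₀], hξ₀, γ] + Pe[EW[A, 0, x₀], hE, ξ[A, 0, y₁], hξ₁, β] -
        2 * ((Real.log w : ℝ) : ℂ) = 0 := by
  -- (R4)+(R1) along `[d]^w : E^w(x₀) → E^w(−x₀)`: `(ξ_{(−x₀, d y₁)}, γ) ∼ (ξ_{(x₀, y₁)}, β)`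
  have h1 := xi_cmI_derivation hd hE hE' hξ₁ hξd hγ
  -- (R1)+(R2) on `E^w(−x₀)`: `ξ_{(−x₀, y₀)} + ξ_{(−x₀, d y₁)} ∼ 2·w dx`
  have h2 := xi_sum_derivation hE' hD hy hξ₀ hξd γ
  -- (R4)+(R1) along `ψ = (x − (−x₀), w) : E^w(−x₀) → 𝔾ₘ`
  obtain ⟨δ, hδ⟩ := exists_psiPath (A := A) (B := (0 : ℂ)) (x₀ := -x₀) hx₀.neg γ
  have h3 := wdx_derivation hE' hx₀.neg (γ := γ) (δ := δ) fun t _ => hδ t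
  -- (R5)+(R4): `(𝔾ₘ, v du, δ) ∼ ℓ(log w)`, the first coordinate `r + x_r` of `δ` being real and positive
  have hδr : ∀ t ∈ Icc (0 : ℝ) 1, δ.toFun t 0 = ((r t + xr : ℝ) : ℂ) := fun t ht => by
    rw [hδ t, Matrix.cons_val_zero, hr t ht, hxr]
    push_cast
    ring
  have hδpos : ∀ t ∈ Icc (0 : ℝ) 1, 0 < r t + xr := fun t ht => by linarith [hpos t ht]
  have h4 := span_realPos_logSym δ (r := fun t => r t + xr) hδr hδpos hw E hEd
  have h45 := period_eq_of_span h4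
  have h5 := period_realLogPath E hEd
  refine ⟨?_, ?_⟩
  · obtain ⟨k, ρ, a, hρ, ha, hsum⟩ := span_add (span_sub (span_sub h2.1 h1.1)
      (span_smul Ell.isAlgebraic_two h3.1)) (span_smul Ell.isAlgebraic_two h4)
    refine ⟨k, ρ, a, hρ, ha, ?_⟩
    rw [← hsum]
    simp only [smul_sub]
    abel
  · linear_combination h2.2 - h1.2 - 2 * h3.2 + 2 * h45 + 2 * h5

/-- **The two lifts of a plane path and of its unit image.**  For a path `g` on `E_{A,0}` with `x∘g ≠ −x₀` on
`[0, 1]` (`x₀ ∈ ℚ̄`, `d² = −1`): the lift `γ = g^w = (x, y, 1/(x + x₀))` of `g` to `E^w(−x₀)`, the lift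
`β = ([d]g)^w = (−x, d·y, 1/(−x − x₀))` of `[d]g` to `E^w(x₀)`, and `γ = [−d]^w β` on `[0, 1]`. -/
theorem exists_liftPair {d : ℂ} (hd : d ^ 2 = -1) (hx₀ : IsAlgebraic ℚ x₀)
    {g : CurvePath (weierCurve A 0)} (h0 : ∀ t ∈ Icc (0 : ℝ) 1, g.toFun t 0 ≠ -x₀) :
    ∃ (γ : CurvePath EW[A, 0, -x₀]) (β : CurvePath EW[A, 0, x₀]),
      (∀ t, γ.toFun t = ![g.toFun t 0, g.toFun t 1, (g.toFun t 0 - -x₀)⁻¹]) ∧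
      (∀ t, β.toFun t = ![-g.toFun t 0, d * g.toFun t 1, (-g.toFun t 0 - x₀)⁻¹]) ∧
      ∀ t ∈ Icc (0 : ℝ) 1, γ.toFun t = ![-β.toFun t 0, -d * β.toFun t 1, -β.toFun t 2] := by
  obtain ⟨γ, hγ⟩ := exists_poleChartPath (A := A) (B := (0 : ℂ)) (x₀ := -x₀) hx₀.neg h0
  obtain ⟨g', hg'⟩ := exists_cmIPath hd g
  have h0' : ∀ t ∈ Icc (0 : ℝ) 1, g'.toFun t 0 ≠ x₀ := fun t ht h => by
    rw [hg' t, Matrix.cons_val_zero] at h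
    exact h0 t ht (by linear_combination -h)
  obtain ⟨β, hβ⟩ := exists_poleChartPath (A := A) (B := (0 : ℂ)) (x₀ := x₀) hx₀ h0'
  refine ⟨γ, β, hγ, fun t => ?_, fun t _ => ?_⟩
  · rw [hβ t, hg' t]
    simp
  · rw [hγ t, hβ t, hg' t]
    funext i
    fin_cases i
    · simp
    · simp only [Fin.mk_one, Fin.isValue, Matrix.cons_val_one, Matrix.cons_val_zero, Matrix.cons_val]
      linear_combination (g.toFun t 1) * hd
    · simp only [Fin.reduceFinMk, Fin.isValue, Matrix.cons_val, Matrix.cons_val_zero]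
      rw [show -g.toFun t 0 - x₀ = -(g.toFun t 0 - -x₀) by ring, inv_neg, neg_neg]

/-- `(−i)² = −1`. -/
theorem neg_I_sq' : (-I) ^ 2 = -1 := by rw [neg_sq]; exact I_sq

/-- **Third kind, rule `IMG2` on the corpus curves** (tests E1-21, E1-22): on `y² = x³ + ax`,
`a ∈ {−1, −25, −1156, −36}`, for algebraic `x₀, y₀, y₁` with `y₀ = i·y₁` (poles `Q = (−x₀, y₀) = [i](x₀, y₁)`
and `P = (x₀, y₁)`), EVERY path `β` on `E^w(x₀)` and `γ = [−i]^w β = (−x∘β, −i·y∘β, −w∘β)` on `[0, 1]` (so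
`β = [i]^w γ`: kz1p's `g2 = [i]g1`, `γ = g1^w`, `β = g2^w`) with `x∘γ = r` real `> −x₀` on `[0, 1]` and
`w·(r(0) + x₀) = r(1) + x₀`: `(E^w(−x₀), ξ_Q, γ) + (E^w(x₀), ξ_P, β) − 2·ℓ(log w) ∈ ⟨(R1)–(R5)⟩_ℚ̄` and
`ξ_Q(γ) + ξ_P(β) − 2 log w = 0` — kz1p: `ξ_{Ai}(g1) + ξ_A(g2) − 2·LOGX:A:g2 = 0`, `LOGX = log w`. -/
theorem corpus_xi_img2 {a : ℂ} (ha : a = -1 ∨ a = -25 ∨ a = -1156 ∨ a = -36) {y₀ y₁ : ℂ}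
    (hx₀ : IsAlgebraic ℚ x₀) (hy₀ : IsAlgebraic ℚ y₀) (hy₁ : IsAlgebraic ℚ y₁) (hy : y₀ + -I * y₁ = 0)
    {β : CurvePath EW[a, 0, x₀]} {γ : CurvePath EW[a, 0, -x₀]}
    (hγ : ∀ t ∈ Icc (0 : ℝ) 1, γ.toFun t = ![-β.toFun t 0, -I * β.toFun t 1, -β.toFun t 2])
    {xr : ℝ} (hxr : x₀ = xr) {r : ℝ → ℝ} (hr : ∀ t ∈ Icc (0 : ℝ) 1, γ.toFun t 0 = (r t : ℂ))
    (hpos : ∀ t ∈ Icc (0 : ℝ) 1, -xr < r t) {w : ℝ} (hw : w * (r 0 + xr) = r 1 + xr)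
    (E : CurvePath 𝔾m)
    (hEd : ∀ t, E.toFun t = ![exp ((1 - t) * 0 + t * ((Real.log w : ℝ) : ℂ)),
      exp (-((1 - t) * 0 + t * ((Real.log w : ℝ) : ℂ)))]) :
    InSpanRel (Sy[EW[a, 0, -x₀], corpus_smoothEW ha hx₀.neg, ξ[a, 0, y₀], corpus_xi ha hy₀, γ] +
        Sy[EW[a, 0, x₀], corpus_smoothEW ha hx₀, ξ[a, 0, y₁], corpus_xi ha hy₁, β] -
        (2 : ℂ) • Finsupp.single (logSym E) 1) ∧
      Pe[EW[a, 0, -x₀], corpus_smoothEW ha hx₀.neg, ξ[a, 0, y₀], corpus_xi ha hy₀, γ] +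
        Pe[EW[a, 0, x₀], corpus_smoothEW ha hx₀, ξ[a, 0, y₁], corpus_xi ha hy₁, β] -
        2 * ((Real.log w : ℝ) : ℂ) = 0 :=
  xi_img2_derivation neg_I_sq' _ _ (disc_ne_zero_left (corpus_a ha).2) hx₀ hy _ _
    (corpus_xi ha ((isAlgebraic_of_sq_eq_neg_one neg_I_sq').mul hy₁)) hγ hxr hr hpos hw E hEd

/-! ### An arc of `E_{A,B}(ℝ)` between two points of one real component -/

/-- **An arc between two points on the same side of the `x`-axis.**  Let `A, B, x_a, y_a, x_b, y_b` be real,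
`(x_a, y_a), (x_b, y_b) ∈ E_{A,B}` with `y_a·y_b > 0`, `x³ + Ax + B > 0` between `x_a` and `x_b`, and
`x_a, y_a, x_b, y_b ∈ ℚ̄`.  Then `X = x_a + (x_b − x_a)t`, `Y = y_a·√(f(X))/√(f(x_a))` (`f(x) = x³ + Ax + B`) is a
`C¹` path on `E_{A,B}` from `(x_a, y_a)` (`t = 0`) to `(x_b, y_b)` (`t = 1`) with `X` between `x_a` and `x_b` on
`[0, 1]` (`Y² = f(X)` as `y_a² = f(x_a)`; `Y(1) = y_a·|y_b|/|y_a| = y_b` as `y_a y_b > 0`). -/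
theorem exists_arcPath2 {Ar Br xa ya xb yb : ℝ} (hA : A = Ar) (hB : B = Br)
    (ha : ya ^ 2 = xa ^ 3 + Ar * xa + Br) (hb : yb ^ 2 = xb ^ 3 + Ar * xb + Br) (hab : 0 < ya * yb)
    (hf : ∀ X ∈ uIcc xa xb, 0 < X ^ 3 + Ar * X + Br)
    (hxa : IsAlgebraic ℚ (xa : ℂ)) (hya : IsAlgebraic ℚ (ya : ℂ)) (hxb : IsAlgebraic ℚ (xb : ℂ))
    (hyb : IsAlgebraic ℚ (yb : ℂ)) :
    ∃ (X Y : ℝ → ℝ) (γ : CurvePath (weierCurve A B)),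
      (∀ t, γ.toFun t = ![(X t : ℂ), (Y t : ℂ)]) ∧ (∀ t, X t = xa + (xb - xa) * t) ∧
      (X 0 = xa ∧ Y 0 = ya) ∧ (X 1 = xb ∧ Y 1 = yb) ∧ ∀ t ∈ Icc (0 : ℝ) 1, X t ∈ uIcc xa xb := by
  subst hA hB
  obtain ⟨X, hX⟩ : ∃ X : ℝ → ℝ, X = fun t => xa + (xb - xa) * t := ⟨_, rfl⟩
  have hXt : ∀ t, X t = xa + (xb - xa) * t := fun t => by rw [hX]
  have hXb : ∀ t ∈ Icc (0 : ℝ) 1, X t ∈ uIcc xa xb := by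
    intro t ht
    rw [Set.mem_uIcc, hXt]
    rcases le_or_gt xa xb with h | h
    · left
      constructor <;> nlinarith [mul_nonneg (sub_nonneg.2 h) ht.1,
        mul_nonneg (sub_nonneg.2 h) (sub_nonneg.2 ht.2)]
    · right
      constructor <;> nlinarith [mul_nonneg (sub_nonneg.2 h.le) ht.1,
        mul_nonneg (sub_nonneg.2 h.le) (sub_nonneg.2 ht.2)]
  have hfa : 0 < xa ^ 3 + Ar * xa + Br := hf xa left_mem_uIcc
  have hft : ∀ t ∈ Icc (0 : ℝ) 1, 0 < X t ^ 3 + Ar * X t + Br := fun t ht => hf _ (hXb t ht)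
  have hVa : √(xa ^ 3 + Ar * xa + Br) ≠ 0 := (Real.sqrt_pos.2 hfa).ne'
  obtain ⟨Y, hY⟩ : ∃ Y : ℝ → ℝ, Y = fun t =>
      ya * √(X t ^ 3 + Ar * X t + Br) / √(xa ^ 3 + Ar * xa + Br) := ⟨_, rfl⟩
  have hYt : ∀ t, Y t = ya * √(X t ^ 3 + Ar * X t + Br) / √(xa ^ 3 + Ar * xa + Br) :=
    fun t => by rw [hY]
  have hXC : ContDiff ℝ 1 X := by
    rw [hX]
    exact contDiff_const.add (contDiff_const.mul contDiff_id)
  have hfXC : ContDiff ℝ 1 fun t => X t ^ 3 + Ar * X t + Br :=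
    ((hXC.pow 3).add (contDiff_const.mul hXC)).add contDiff_const
  have hYC : ContDiffOn ℝ 1 Y (Icc 0 1) := by
    rw [hY]
    exact (contDiff_const.contDiffOn.mul (hfXC.contDiffOn.sqrt fun t ht => (hft t ht).ne')).div_const _
  -- the curve equation on `[0, 1]`
  have hcurve : ∀ t ∈ Icc (0 : ℝ) 1, Y t ^ 2 = X t ^ 3 + Ar * X t + Br := by
    intro t ht
    have hW : (√(X t ^ 3 + Ar * X t + Br)) ^ 2 = X t ^ 3 + Ar * X t + Br :=
      Real.sq_sqrt (hft t ht).le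
    have hV : (√(xa ^ 3 + Ar * xa + Br)) ^ 2 = xa ^ 3 + Ar * xa + Br := Real.sq_sqrt hfa.le
    rw [hYt, div_pow, mul_pow, hW, hV, div_eq_iff hfa.ne', ha]
    ring
  have hx0 : X 0 = xa := by rw [hXt]; ring
  have hx1 : X 1 = xb := by rw [hXt]; ring
  have hy0 : Y 0 = ya := by rw [hYt, hx0, mul_div_assoc, div_self hVa, mul_one]
  have hya0 : ya ≠ 0 := fun h => by rw [h, zero_mul] at hab; exact lt_irrefl _ hab
  have hq : 0 < yb / ya := by
    rcases mul_pos_iff.1 hab with ⟨h1, h2⟩ | ⟨h1, h2⟩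
    · exact div_pos h2 h1
    · exact div_pos_of_neg_of_neg h2 h1
  have hy1 : Y 1 = yb := by
    rw [hYt, hx1, ← hb, ← ha, Real.sqrt_sq_eq_abs, Real.sqrt_sq_eq_abs, mul_div_assoc, ← abs_div,
      abs_of_pos hq]
    field_simp
  obtain ⟨φ, hφ⟩ : ∃ φ : ℝ → Fin 2 → ℂ, φ = fun t => ![(X t : ℂ), (Y t : ℂ)] := ⟨_, rfl⟩
  have e0 : (fun t : ℝ => ((X t : ℝ) : ℂ)) = ⇑Complex.ofRealCLM ∘ X := by funext t; simp
  have e1 : (fun t : ℝ => ((Y t : ℝ) : ℂ)) = ⇑Complex.ofRealCLM ∘ Y := by funext t; simp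
  refine ⟨X, Y, { toFun := φ
                  contDiffOn := ?_
                  mem_points := ?_
                  algebraic_zero := ?_
                  algebraic_one := ?_ }, fun t => by show φ t = _; rw [hφ], hXt,
    ⟨hx0, hy0⟩, ⟨hx1, hy1⟩, hXb⟩
  · rw [contDiffOn_pi]
    intro j
    rw [hφ]
    fin_cases j
    · simp only [Fin.zero_eta, Matrix.cons_val_zero]
      rw [e0]
      exact (Complex.ofRealCLM.contDiff.comp hXC).contDiffOn
    · simp only [Fin.mk_one, Matrix.cons_val_one, Matrix.cons_val_zero]
      rw [e1]
      exact Complex.ofRealCLM.contDiff.comp_contDiffOn hYC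
  · intro t ht
    rw [Weier.mem_points_iff, Weier.eval_fPoly, hφ]
    simp only [Matrix.cons_val_zero, Matrix.cons_val_one]
    exact_mod_cast hcurve t ht
  · intro i
    rw [hφ]
    fin_cases i
    · simpa [hx0] using hxa
    · simpa [hy0] using hya
  · intro i
    rw [hφ]
    fin_cases i
    · simpa [hx1] using hxb
    · simpa [hy1] using hyb

end Summit.KontsevichZagierPeriods.KzOnePeriods.XiDerivation

end
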